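import Literature.NumberTheory.IwasawaTheory.ClassicalMuVanishesIffBoundedRank
import Literature.NumberTheory.IwasawaTheory.ClassicalMuVanishesSemidihedralDescent
import HarnessLib

set_option autoImplicit false

/-!
# The Klein-four and semidihedral (`SD₁₆ = N_ns(3)`) μ-descents WITHOUT Iwasawa's growth theorem

Topic `NumberTheory/IwasawaTheory` (namespace = path). THEOREM-ONLY file (no definition, no named fact, no `sorry`), written by the
prover seat `bsd-potss-k8t-c4` g22 (cell `bsd-potss`; μ-road of stmt-BirchSwinnertonDyer-19982; closes nothing).

hI-FREE TWINS of `ClassicalMuVanishesKleinDescent.classicalMuVanishes_restrict_of_klein_four` /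
`…_of_isCyclotomic_of_klein_four` / `…_of_isCyclotomic_of_klein_four_rat` (seat `bsd-potss-conjA-anchor` g10/g11) and of
`ClassicalMuVanishesSemidihedralDescent.classicalMuVanishes_of_isCyclotomic_of_semidihedral_rat` (g11): same statements with the binder
`(hI : iwasawa1959_classNumberPExp_growth)` REMOVED.  The originals used the growth theorem only to turn the per-layer inequalities of a
norm relation / a `p`-prime-index inclusion back into the growth form; `ClassicalMuVanishesIffBoundedRank` (g22: «`μ = 0` iff bounded
`p`-ranks», both directions at finite level) does that unconditionally (`classicalMuVanishes_restrict_of_normRelation'`,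
`classicalMuVanishes_of_isCyclotomic_of_tower'`).  Proofs are those of the originals, line by line, with the two calls swapped.
Ferrero–Washington (`hFW`) remains a named-fact hypothesis where the originals have it.

References: [BiasseEtAl2022] Example 2.5, Prop. 3.7; [Washington1997] §13.1, §7.5, §13.3 Prop. 13.23; [MilneFT2022] Ch. 3;
[NeukirchANT1999] Ch. III §1 Prop. (1.6) (ii).
-/

noncomputable section

open scoped NumberField

open Field IntermediateField Literature.NumberTheory.GaloisRepresentations Literature.NumberTheory.EllipticCurves
  Literature.NumberTheory.EllipticCurves.ZpExtension Literature.NumberTheory.NumberFields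

namespace Literature.NumberTheory.IwasawaTheory

variable {F : Type} [Field F] [NumberField F] {p : ℕ} [Fact p.Prime]

/-! ### §1 Klein four, hI-free -/

omit [NumberField F] [Fact p.Prime] in
/-- `p ∤ [E : F]` for an intermediate field `E` of `L/F` when `p ∤ [L : F]`. [folklore] -/
private theorem not_dvd_finrank_intermediateField' {L : Type} [Field L] [Algebra F L] [FiniteDimensional F L]
    (hp : ¬ p ∣ Module.finrank F L) (E : IntermediateField F L) : ¬ p ∣ Module.finrank F ↥E := fun h =>
  hp (h.trans (Dvd.intro _ (Module.finrank_mul_finrank F ↥E L)))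

/-- **μ-descent through a Klein four-group, hI-free** (twin of `classicalMuVanishes_restrict_of_klein_four`): `κ` a `ℤ_p`-extension of `F`,
`p ≠ 2`, `L/F` finite Galois with `κ ∘ res` onto, `u, v ∈ Gal(L/F)` commuting involutions, `u ≠ v`, `u, v ≠ 1`; if the towers of
`L^{⟨u⟩}`, `L^{⟨v⟩}`, `L^{⟨uv⟩}` have `μ = 0` (growth form), so does `L·F_∞/L` (norm relation `2 = N_⟨u⟩ + N_⟨v⟩ − u N_⟨uv⟩`).
[cite: BiasseEtAl2022, Example 2.5, Prop. 3.7] [cite: Washington1997, §13.1] -/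
theorem classicalMuVanishes_restrict_of_klein_four' (hp2 : p ≠ 2)
    (κ : ZpExtension F p) (L : Type) [Field L] [NumberField L] [Algebra F L] [IsGalois F L]
    (hL : Function.Surjective (κ.toContinuousMonoidHom.comp (absGaloisRestrict F L)))
    {u v : L ≃ₐ[F] L} (hu : u * u = 1) (hv : v * v = 1) (huv : u * v = v * u) (hu1 : u ≠ 1) (hv1 : v ≠ 1)
    (hne : u ≠ v)
    (hsu : Function.Surjective
      (κ.toContinuousMonoidHom.comp (absGaloisRestrict F ↥(fixedField (Subgroup.zpowers u)))))
    (hsv : Function.Surjective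
      (κ.toContinuousMonoidHom.comp (absGaloisRestrict F ↥(fixedField (Subgroup.zpowers v)))))
    (hsuv : Function.Surjective
      (κ.toContinuousMonoidHom.comp (absGaloisRestrict F ↥(fixedField (Subgroup.zpowers (u * v))))))
    (hμu : ClassicalMuVanishes (κ.restrict ↥(fixedField (Subgroup.zpowers u)) hsu))
    (hμv : ClassicalMuVanishes (κ.restrict ↥(fixedField (Subgroup.zpowers v)) hsv))
    (hμuv : ClassicalMuVanishes (κ.restrict ↥(fixedField (Subgroup.zpowers (u * v))) hsuv)) :
    ClassicalMuVanishes (κ.restrict L hL) := by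
  classical
  haveI : FiniteDimensional F L := Module.Finite.of_restrictScalars_finite ℚ F L
  have hpd : ¬ p ∣ 2 := fun h => hp2 ((Nat.prime_dvd_prime_iff_eq (Fact.out : p.Prime) Nat.prime_two).mp h)
  let Hs : Fin 3 → Subgroup (L ≃ₐ[F] L) :=
    ![Subgroup.zpowers u, Subgroup.zpowers v, Subgroup.zpowers (u * v)]
  have hH : ∀ i, Function.Surjective
      (κ.toContinuousMonoidHom.comp (absGaloisRestrict F ↥(fixedField (Hs i)))) := by
    intro i
    fin_cases i
    · exact hsu
    · exact hsv
    · exact hsuv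
  refine classicalMuVanishes_restrict_of_normRelation' κ L hL Hs
    (![fun x => if x = 1 then (1 : ℤ) else 0, fun x => if x = 1 then (1 : ℤ) else 0,
      fun x => if x = u then (-1 : ℤ) else 0])
    (fun (_ : Fin 3) (y : L ≃ₐ[F] L) => if y = 1 then (1 : ℤ) else 0) hpd
    (NormRelation.normRelation_klein_four hu hv huv hu1 hv1 hne) hH ?_
  intro i
  fin_cases i
  · exact hμu
  · exact hμv
  · exact hμuv

/-- **Consumer form of the Klein descent, hI-free** (twin of `classicalMuVanishes_of_isCyclotomic_of_klein_four`): `κ` cyclotomic, `p ≠ 2`,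
`L/F` finite Galois with `p ∤ [L : F]`, `u, v` commuting involutions, `u ≠ v`, `u, v ≠ 1`, `uv` conjugate to `v`; `μ = 0` for every cyclotomic
`ℤ_p`-extension of `L^{⟨u⟩}` and of `L^{⟨v⟩}` ⟹ the same for `L`. [cite: BiasseEtAl2022, Example 2.5, Prop. 3.7] [cite: Washington1997, §13.1] -/
theorem classicalMuVanishes_of_isCyclotomic_of_klein_four' (hp2 : p ≠ 2)
    (κ : ZpExtension F p) (hκ : κ.IsCyclotomic) (L : Type) [Field L] [NumberField L] [Algebra F L] [IsGalois F L]
    (hp : ¬ p ∣ Module.finrank F L)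
    {u v : L ≃ₐ[F] L} (hu : u * u = 1) (hv : v * v = 1) (huv : u * v = v * u) (hu1 : u ≠ 1) (hv1 : v ≠ 1)
    (hne : u ≠ v) (hconj : ∃ g : L ≃ₐ[F] L, g * v * g⁻¹ = u * v)
    (hμu : ∀ κE : ZpExtension ↥(fixedField (Subgroup.zpowers u)) p, κE.IsCyclotomic → ClassicalMuVanishes κE)
    (hμv : ∀ κE : ZpExtension ↥(fixedField (Subgroup.zpowers v)) p, κE.IsCyclotomic → ClassicalMuVanishes κE)
    (κL : ZpExtension L p) (hκL : κL.IsCyclotomic) : ClassicalMuVanishes κL := by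
  haveI : FiniteDimensional F L := Module.Finite.of_restrictScalars_finite ℚ F L
  have hL := surjective_comp_absGaloisRestrict_of_not_dvd_finrank κ L hp
  have hs : ∀ H : Subgroup (L ≃ₐ[F] L), Function.Surjective
      (κ.toContinuousMonoidHom.comp (absGaloisRestrict F ↥(fixedField H))) := fun H =>
    surjective_comp_absGaloisRestrict_of_not_dvd_finrank κ _ (not_dvd_finrank_intermediateField' hp (fixedField H))
  obtain ⟨g, hg⟩ := hconj
  have hmap : (Subgroup.zpowers v).map (MulAut.conj g).toMonoidHom = Subgroup.zpowers (u * v) := by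
    rw [MonoidHom.map_zpowers]
    exact congrArg Subgroup.zpowers hg
  obtain ⟨φ⟩ := nonempty_algEquiv_fixedField_conj (F := F) (Subgroup.zpowers v) g
  have φ' : ↥(fixedField (Subgroup.zpowers v)) ≃ₐ[F] ↥(fixedField (Subgroup.zpowers (u * v))) :=
    φ.trans (IntermediateField.equivOfEq (congrArg fixedField hmap))
  have h1 : ClassicalMuVanishes (κ.restrict L hL) :=
    classicalMuVanishes_restrict_of_klein_four' hp2 κ L hL hu hv huv hu1 hv1 hne (hs _) (hs _) (hs _)
      (hμu _ (isCyclotomic_restrict κ hκ _ (hs _))) (hμv _ (isCyclotomic_restrict κ hκ _ (hs _)))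
      ((classicalMuVanishes_restrict_iff_of_algEquiv κ φ' (hs _) (hs _)).mp
        (hμv _ (isCyclotomic_restrict κ hκ _ (hs _))))
  exact (classicalMuVanishes_iff_of_isCyclotomic _ _ (isCyclotomic_restrict κ hκ L hL) hκL).mp h1

/-- **The `D₄`-shape over `ℚ`, hI-free** (twin of `classicalMuVanishes_of_isCyclotomic_of_klein_four_rat`; Ferrero–Washington still by name
for the abelian field `L^{⟨u⟩}`): `μ(L) = 0 ⟸ μ(L^{⟨v⟩}) = 0`. [cite: BiasseEtAl2022, Example 2.5, Prop. 3.7] [cite: Washington1997, §13.1, §7.5] -/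
theorem classicalMuVanishes_of_isCyclotomic_of_klein_four_rat'
    (hFW : ferreroWashington1979_classicalMuVanishes) (hp2 : p ≠ 2)
    (L : Type) [Field L] [NumberField L] [IsGalois ℚ L] (hp : ¬ p ∣ Module.finrank ℚ L)
    {u v : L ≃ₐ[ℚ] L} (hu : u * u = 1) (hv : v * v = 1) (huv : u * v = v * u) (hu1 : u ≠ 1) (hv1 : v ≠ 1)
    (hne : u ≠ v) (hconj : ∃ g : L ≃ₐ[ℚ] L, g * v * g⁻¹ = u * v)
    (hcomm : ∀ a b : L ≃ₐ[ℚ] L, a * b * a⁻¹ * b⁻¹ ∈ Subgroup.zpowers u)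
    (hμv : ∀ κE : ZpExtension ↥(fixedField (Subgroup.zpowers v)) p, κE.IsCyclotomic → ClassicalMuVanishes κE)
    (κL : ZpExtension L p) (hκL : κL.IsCyclotomic) : ClassicalMuVanishes κL := by
  obtain ⟨κ, hκ⟩ := exists_cyclotomicZpExtension_holds ℚ p
  haveI hN : (Subgroup.zpowers u).Normal := by
    refine ⟨fun h hh a => ?_⟩
    have h1 : a * h * a⁻¹ * h⁻¹ ∈ Subgroup.zpowers u := hcomm a h
    have h2 : a * h * a⁻¹ = (a * h * a⁻¹ * h⁻¹) * h := by group
    rw [h2]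
    exact Subgroup.mul_mem _ h1 hh
  haveI : IsAbelianGalois ℚ ↥(fixedField (Subgroup.zpowers u)) :=
    isAbelianGalois_fixedField_of_commutator_mem (Subgroup.zpowers u) hcomm
  exact classicalMuVanishes_of_isCyclotomic_of_klein_four' hp2 κ hκ L hp hu hv huv hu1 hv1 hne hconj
    (fun κE hκE => hFW _ p κE hκE) hμv κL hκL

/-! ### §2 Semidihedral shape, hI-free -/

omit [NumberField F] in
/-- For `N ⊴ Gal(L/F)`, `N ≤ H`, `M = L^N`: the fixed field in `M` of the image of `H` in `Gal(M/F)` lifts to `L^H`.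
[cite: MilneFT2022, Ch. 3 (fundamental theorem)] -/
private theorem lift_fixedField_eq_of_map_restrictNormalHom' {L : Type} [Field L] [Algebra F L] [FiniteDimensional F L]
    [IsGalois F L] (N H : Subgroup (L ≃ₐ[F] L)) [N.Normal] (hNH : N ≤ H)
    (H' : Subgroup (↥(fixedField N) ≃ₐ[F] ↥(fixedField N)))
    (hH' : H.map (AlgEquiv.restrictNormalHom ↥(fixedField N)) = H') :
    IntermediateField.lift (fixedField H') = fixedField H := by
  have h1 := InfiniteGalois.restrict_fixedField H (fixedField N)
  rw [hH'] at h1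
  rw [← h1]
  exact inf_eq_left.mpr (IntermediateField.fixedField_le hNH)

omit [NumberField F] in
/-- Hence `M^{H̄} ≃ₐ[F] L^H`. [cite: MilneFT2022, Ch. 3 (fundamental theorem)] -/
private theorem nonempty_algEquiv_fixedField_of_map_restrictNormalHom' {L : Type} [Field L] [Algebra F L]
    [FiniteDimensional F L] [IsGalois F L] (N H : Subgroup (L ≃ₐ[F] L)) [N.Normal] (hNH : N ≤ H)
    (H' : Subgroup (↥(fixedField N) ≃ₐ[F] ↥(fixedField N)))
    (hH' : H.map (AlgEquiv.restrictNormalHom ↥(fixedField N)) = H') :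
    Nonempty (↥(fixedField H') ≃ₐ[F] ↥(fixedField H)) :=
  ⟨(IntermediateField.liftAlgEquiv (fixedField H')).trans
    (IntermediateField.equivOfEq (lift_fixedField_eq_of_map_restrictNormalHom' N H hNH H' hH'))⟩

/-- The cyclic subgroup generated by an involution `t` is `{1, t}`. [folklore] -/
private theorem mem_zpowers_iff_of_mul_self' {G : Type*} [Group G] {t x : G} (ht : t * t = 1) :
    x ∈ Subgroup.zpowers t ↔ x = 1 ∨ x = t := by
  have h2 : t ^ (2 : ℤ) = 1 := by rw [zpow_two]; exact ht
  constructor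
  · intro hx
    rw [Subgroup.mem_zpowers_iff] at hx
    obtain ⟨k, rfl⟩ := hx
    rcases Int.emod_two_eq_zero_or_one k with hk | hk
    · left
      rw [← Int.mul_ediv_add_emod k 2, zpow_add, zpow_mul, h2, one_zpow, one_mul, hk, zpow_zero]
    · right
      rw [← Int.mul_ediv_add_emod k 2, zpow_add, zpow_mul, h2, one_zpow, one_mul, hk, zpow_one]
  · intro hx
    rcases hx with hx | hx
    · rw [hx]; exact one_mem _
    · rw [hx]; exact Subgroup.mem_zpowers t

/-- **`μ(L) = 0 ⟸ μ(L^{⟨s⟩}) = 0` for a Galois group of `SD₁₆ = N_ns(3)` shape, hI-FREE** (twin of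
`classicalMuVanishes_of_isCyclotomic_of_semidihedral_rat`; Ferrero–Washington by name for the abelian field `L^{⟨w⟩}`): `L/ℚ` finite Galois,
`p` odd with `p ∤ [L : ℚ]`; `w, s ∈ Gal(L/ℚ)` with `z = w²` central, `z² = 1 ≠ z`, `s² = 1`, `s ∉ {1, z}`, `s w s⁻¹ = w⁻¹`, `w ∉ {s, z s}`,
`g s g⁻¹ = w³ s` for some `g`, `⟨w⟩ ⊇ [G, G]`.  If `μ = 0` holds for every cyclotomic `ℤ_p`-extension of `L^{⟨s⟩}`, then for every
cyclotomic `ℤ_p`-extension of `L`.  (For `L = ℚ(E[3])`, `Gal ≅ N_ns(3)`: `L^{⟨s⟩} = ℚ(P)`, degree `8`.)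
[cite: BiasseEtAl2022, Example 2.5, Prop. 3.7] [cite: Washington1997, §13.1, §7.5] [cite: NeukirchANT1999, Ch. III §1 Prop. (1.6) (ii)] -/
theorem classicalMuVanishes_of_isCyclotomic_of_semidihedral_rat'
    (hFW : ferreroWashington1979_classicalMuVanishes) (hp2 : p ≠ 2)
    (L : Type) [Field L] [NumberField L] [IsGalois ℚ L] (hp : ¬ p ∣ Module.finrank ℚ L)
    {w s : L ≃ₐ[ℚ] L} (hzc : ∀ g : L ≃ₐ[ℚ] L, g * (w * w) = (w * w) * g) (hz4 : (w * w) * (w * w) = 1)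
    (hz1 : w * w ≠ 1) (hs : s * s = 1) (hs1 : s ≠ 1) (hsz : s ≠ w * w) (hdih : s * w * s⁻¹ = w⁻¹)
    (hws : w ≠ s) (hwzs : w ≠ w * w * s) (hconj : ∃ g : L ≃ₐ[ℚ] L, g * s * g⁻¹ = w * w * w * s)
    (hcomm : ∀ a b : L ≃ₐ[ℚ] L, a * b * a⁻¹ * b⁻¹ ∈ Subgroup.zpowers w)
    (hμs : ∀ κE : ZpExtension ↥(fixedField (Subgroup.zpowers s)) p, κE.IsCyclotomic → ClassicalMuVanishes κE)
    (κL : ZpExtension L p) (hκL : κL.IsCyclotomic) : ClassicalMuVanishes κL := by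
  obtain ⟨κ, hκ⟩ := exists_cyclotomicZpExtension_holds ℚ p
  set z : L ≃ₐ[ℚ] L := w * w with hz
  have hwinv : w⁻¹ = w * z := inv_eq_of_mul_eq_one_right (by rw [← mul_assoc, ← hz]; exact hz4)
  have hsw : s * w = w * z * s := by
    have h1 : s * w = w⁻¹ * s := by
      calc s * w = s * w * s⁻¹ * s := by group
        _ = w⁻¹ * s := by rw [hdih]
    rw [h1, hwinv]
  have hconj₁ : w * s * w⁻¹ = z * s := by
    have h1 : s * w⁻¹ * s⁻¹ = w := by
      have := congrArg (·⁻¹) hdih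
      simpa only [mul_inv_rev, inv_inv, ← mul_assoc] using this
    calc w * s * w⁻¹ = w * (s * w⁻¹ * s⁻¹) * s := by group
      _ = z * s := by rw [h1, ← hz]
  haveI hzN : (Subgroup.zpowers z).Normal := by
    refine ⟨fun h hh a => ?_⟩
    rw [mem_zpowers_iff_of_mul_self' hz4] at hh
    rcases hh with hh | hh <;> rw [hh]
    · rw [mul_one, mul_inv_cancel]; exact one_mem _
    · rw [hzc a, mul_assoc, mul_inv_cancel, mul_one]; exact Subgroup.mem_zpowers z
  haveI hwN : (Subgroup.zpowers w).Normal := by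
    refine ⟨fun h hh a => ?_⟩
    have h1 : a * h * a⁻¹ * h⁻¹ ∈ Subgroup.zpowers w := hcomm a h
    have h2 : a * h * a⁻¹ = (a * h * a⁻¹ * h⁻¹) * h := by group
    rw [h2]
    exact Subgroup.mul_mem _ h1 hh
  set M : IntermediateField ℚ L := fixedField (Subgroup.zpowers z) with hM
  haveI : IsGalois ℚ ↥M := IsGalois.of_fixedField_normal_subgroup (Subgroup.zpowers z)
  set π : (L ≃ₐ[ℚ] L) →* (↥M ≃ₐ[ℚ] ↥M) := AlgEquiv.restrictNormalHom ↥M with hπ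
  have hker : π.ker = Subgroup.zpowers z := by
    have h1 := IntermediateField.restrictNormalHom_ker (K := ℚ) (L := L) (fixedField (Subgroup.zpowers z))
    rw [IntermediateField.fixingSubgroup_fixedField] at h1
    exact h1
  have hπker : ∀ g : L ≃ₐ[ℚ] L, π g = 1 ↔ g = 1 ∨ g = z := by
    intro g
    rw [← MonoidHom.mem_ker, hker, mem_zpowers_iff_of_mul_self' hz4]
  have hπz : π z = 1 := (hπker z).mpr (Or.inr rfl)
  have hu : π w * π w = 1 := by rw [← map_mul, ← hz, hπz]
  have hv : π s * π s = 1 := by rw [← map_mul, hs, map_one]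
  have huv : π w * π s = π s * π w := by
    rw [← map_mul, ← map_mul, hsw, map_mul, map_mul, map_mul, hπz, mul_one]
  have hu1 : π w ≠ 1 := by
    intro h
    rcases (hπker w).mp h with h1 | h1
    · exact hz1 (by rw [hz, h1, one_mul])
    · apply hz1
      calc z = w * w := hz
        _ = z * z := by rw [h1]
        _ = 1 := hz4
  have hv1 : π s ≠ 1 := by
    intro h
    rcases (hπker s).mp h with h1 | h1
    · exact hs1 h1
    · exact hsz h1
  have hne : π w ≠ π s := by
    intro h
    have h1 : π (w * s⁻¹) = 1 := by rw [map_mul, map_inv, h, mul_inv_cancel]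
    rcases (hπker _).mp h1 with h2 | h2
    · exact hws (by simpa using congrArg (· * s) h2)
    · exact hwzs (by simpa using congrArg (· * s) h2)
  have hconj₂ : ∃ g : ↥M ≃ₐ[ℚ] ↥M, g * π s * g⁻¹ = π w * π s := by
    obtain ⟨g, hg⟩ := hconj
    refine ⟨π g, ?_⟩
    rw [← map_inv, ← map_mul, ← map_mul, hg, map_mul, map_mul, hπz, one_mul]
  have hπw : (Subgroup.zpowers w).map π = Subgroup.zpowers (π w) := MonoidHom.map_zpowers π w
  haveI hπwN : (Subgroup.zpowers (π w)).Normal := by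
    rw [← hπw]
    exact Subgroup.Normal.map hwN π (AlgEquiv.restrictNormalHom_surjective L)
  have hcomm' : ∀ a b : ↥M ≃ₐ[ℚ] ↥M, a * b * a⁻¹ * b⁻¹ ∈ Subgroup.zpowers (π w) := by
    intro a b
    obtain ⟨a, rfl⟩ := AlgEquiv.restrictNormalHom_surjective L a
    obtain ⟨b, rfl⟩ := AlgEquiv.restrictNormalHom_surjective L b
    have h1 : π (a * b * a⁻¹ * b⁻¹) ∈ (Subgroup.zpowers w).map π := Subgroup.mem_map_of_mem π (hcomm a b)
    rw [hπw, map_mul, map_mul, map_mul, map_inv, map_inv] at h1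
    exact h1
  haveI : IsAbelianGalois ℚ ↥(fixedField (Subgroup.zpowers (π w))) :=
    isAbelianGalois_fixedField_of_commutator_mem (Subgroup.zpowers (π w)) hcomm'
  set Hs : Subgroup (L ≃ₐ[ℚ] L) := Subgroup.zpowers s ⊔ Subgroup.zpowers z with hHs
  have hπs : Hs.map π = Subgroup.zpowers (π s) := by
    rw [hHs, Subgroup.map_sup, MonoidHom.map_zpowers, MonoidHom.map_zpowers, hπz, Subgroup.zpowers_one_eq_bot,
      sup_bot_eq]
  obtain ⟨eS⟩ := nonempty_algEquiv_fixedField_of_map_restrictNormalHom' (F := ℚ) (Subgroup.zpowers z) Hs le_sup_right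
    (Subgroup.zpowers (π s)) hπs
  have hle : fixedField Hs ≤ fixedField (Subgroup.zpowers s) := IntermediateField.fixedField_le le_sup_left
  have hμHs : ∀ κK : ZpExtension ↥(fixedField Hs) p, κK.IsCyclotomic → ClassicalMuVanishes κK := by
    letI : Algebra ↥(fixedField Hs) ↥(fixedField (Subgroup.zpowers s)) :=
      (IntermediateField.inclusion hle).toRingHom.toAlgebra
    haveI : IsScalarTower ℚ ↥(fixedField Hs) ↥(fixedField (Subgroup.zpowers s)) :=
      IsScalarTower.of_algebraMap_eq fun _ => rfl
    exact classicalMuVanishes_of_isCyclotomic_of_tower' κ hκ ↥(fixedField Hs) ↥(fixedField (Subgroup.zpowers s))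
      (not_dvd_finrank_intermediateField' hp _) hμs
  have hμv : ∀ κE : ZpExtension ↥(fixedField (Subgroup.zpowers (π s))) p, κE.IsCyclotomic → ClassicalMuVanishes κE :=
    forall_classicalMuVanishes_of_algEquiv eS.symm (not_dvd_finrank_intermediateField' hp _) hμHs
  have hpM : ¬ p ∣ Module.finrank ℚ ↥M := not_dvd_finrank_intermediateField' hp M
  have hμM : ∀ κM : ZpExtension ↥M p, κM.IsCyclotomic → ClassicalMuVanishes κM :=
    classicalMuVanishes_of_isCyclotomic_of_klein_four' hp2 κ hκ ↥M hpM hu hv huv hu1 hv1 hne hconj₂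
      (fun κE hκE => hFW _ p κE hκE) hμv
  have hzs : z * s = s * z := (hzc s).symm
  have hzs_ne : z ≠ s := fun h => hsz h.symm
  exact classicalMuVanishes_of_isCyclotomic_of_klein_four' hp2 κ hκ L hp hz4 hs hzs hz1 hs1 hzs_ne
    ⟨w, hconj₁⟩ hμM hμs κL hκL

end Literature.NumberTheory.IwasawaTheory

end
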